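import Literature.MathematicalPhysics.QuantumLattice.GrassmannWardIdentity
import HarnessLib

/-!
# Integration by parts for the Grassmann Gaussian convolution and the four-point Wick rule

Topic `Literature/MathematicalPhysics/QuantumLattice`; generic layer over `GrassmannLaplacian.lean` /
`GrassmannEffectiveAction.lean` (the `e^{Δ_C}` calculus of Salmhofer 1999, §4.3).  For the Gaussian expectation
`gaussExpect R C F = constPart (e^{Δ_C} F)` of an ARBITRARY covariance `C` (no invertibility, no antisymmetry) we prove

* `grassmannLaplacian_gen_mul` — `Δ_C (ψ(X) a) = ψ(X) Δ_C a + Σ_Y A(X,Y) ∂_Y a` with the two-point function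
  `A(X,Y) = ½ (C(Y,X) − C(X,Y)) = ∫ dμ_C ψ(X)ψ(Y)` (`gaussExpect_gen_mul_gen`);
* `gaussConv_gen_mul` — `μ_C ⋆ (ψ(X) a) = ψ(X) (μ_C ⋆ a) + Σ_Y A(X,Y) ∂_Y (μ_C ⋆ a)`;
* **`gaussExpect_gen_mul`** (integration by parts = Wick's rule, Salmhofer 1999 (4.90)–(4.91); Feldman–Knörrer–Trubowitz
  2002, §I.2): `∫ dμ_C ψ(X) a = Σ_Y A(X,Y) ∫ dμ_C ∂_Y a`;
* `gaussExpect_gen`, `gaussExpect_gen_mul_gen_mul_gen` (odd moments vanish) and the **four-point Wick/Pfaffian rule**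
  `gaussExpect_gen_mul_gen_mul_gen_mul_gen`: `∫ dμ_C ψ₁ψ₂ψ₃ψ₄ = A₁₂A₃₄ − A₁₃A₂₄ + A₁₄A₂₃`.

Everything is proved; no definition is introduced (the pairing operator `Σ_Y A(X,Y) ∂_Y` is written out).  The proof of
`gaussConv_gen_mul` is the one of `chargeOp_gaussConv` (`GrassmannWardIdentity.lean`) with the charge operator replaced by
left multiplication by a field.

## Sources

M. Salmhofer, *Renormalization: An Introduction* (Springer 1999), §4.3.1–4.3.2, (4.86)–(4.91) [`Salmhofer1999`];
J. Feldman, H. Knörrer, E. Trubowitz, *Fermionic Functional Integrals and the Renormalization Group* (CRM Monograph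
Series 16, AMS 2002), §I.2 (integration by parts, Wick / Pfaffian formula) [`FeldmanKnorrerTrubowitz2002`]. [folklore]
-/

noncomputable section

namespace Literature.MathematicalPhysics.QuantumLattice

open GrassmannAlgebra

variable (R : Type*) [CommRing R] [Algebra ℚ R] {Γ : Type*} [Fintype Γ] [DecidableEq Γ]

/-! ### The Laplacian past one field: `Δ_C ψ(X) = ψ(X) Δ_C + Σ_Y A(X,Y) ∂_Y` -/

omit [Fintype Γ] [Algebra ℚ R] in
/-- Two derivatives past one field: `∂_U ∂_V (ψ(X) a) = δ_{VX} ∂_U a − δ_{UX} ∂_V a + ψ(X) ∂_U ∂_V a`. [folklore] -/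
theorem grassmannDeriv_grassmannDeriv_gen_mul (U V X : Γ) (a : GrassmannAlgebra R Γ) :
    grassmannDeriv R U (grassmannDeriv R V (gen R X * a)) =
      (if V = X then grassmannDeriv R U a else 0) - (if U = X then grassmannDeriv R V a else 0) +
        gen R X * grassmannDeriv R U (grassmannDeriv R V a) := by
  rw [grassmannDeriv_gen_mul, map_sub, grassmannDeriv_gen_mul]
  split_ifs <;> (try simp only [map_zero]) <;> abel

/-- **The Laplacian past one field**: `Δ_C (ψ(X) a) = ψ(X) Δ_C a + Σ_Y ½(C(Y,X) − C(X,Y)) ∂_Y a` — the commutator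
`[Δ_C, ψ(X)]` is the first-order operator `Σ_Y A(X,Y) ∂_Y` with the two-point function `A` of `gaussExpect_gen_mul_gen`
(Salmhofer 1999, (4.89)–(4.90)). [cite: Salmhofer1999, §4.3.2 (4.89)–(4.90)] -/
theorem grassmannLaplacian_gen_mul (C : Matrix Γ Γ R) (X : Γ) (a : GrassmannAlgebra R Γ) :
    grassmannLaplacian R C (gen R X * a) =
      gen R X * grassmannLaplacian R C a +
        ∑ Y, (((1 / 2 : ℚ) • (1 : R)) * (C Y X - C X Y)) • grassmannDeriv R Y a := by
  have key : ∀ U : Γ, ∑ V, C U V • grassmannDeriv R U (grassmannDeriv R V (gen R X * a)) =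
      C U X • grassmannDeriv R U a - (if U = X then ∑ V, C U V • grassmannDeriv R V a else 0) +
        gen R X * ∑ V, C U V • grassmannDeriv R U (grassmannDeriv R V a) := by
    intro U
    simp only [grassmannDeriv_grassmannDeriv_gen_mul, smul_add, smul_sub, Finset.sum_add_distrib,
      Finset.sum_sub_distrib, smul_ite, smul_zero, Finset.sum_ite_eq', Finset.mem_univ, if_true, mul_smul_comm,
      Finset.mul_sum]
    by_cases hU : U = X
    · simp only [hU, if_true]
    · simp only [hU, if_false, Finset.sum_const_zero]
  rw [grassmannLaplacian_apply, grassmannLaplacian_apply]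
  simp only [key, Finset.sum_add_distrib, Finset.sum_sub_distrib, Finset.sum_ite_eq', Finset.mem_univ, if_true,
    ← Finset.mul_sum, smul_add, smul_sub, ← mul_smul_comm]
  rw [show (∑ Y, (((1 / 2 : ℚ) • (1 : R)) * (C Y X - C X Y)) • grassmannDeriv R Y a) =
      ((1 / 2 : ℚ) • (1 : R)) • (∑ Y, C Y X • grassmannDeriv R Y a) -
        ((1 / 2 : ℚ) • (1 : R)) • (∑ Y, C X Y • grassmannDeriv R Y a) by
    rw [Finset.smul_sum, Finset.smul_sum, ← Finset.sum_sub_distrib]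
    refine Finset.sum_congr rfl fun Y _ => ?_
    rw [mul_smul, sub_smul, smul_sub]]
  abel

omit [DecidableEq Γ] in
/-- **Derivatives commute with the Laplacian**: `∂_Y Δ_C = Δ_C ∂_Y` (two anticommutations). [folklore] -/
theorem grassmannDeriv_grassmannLaplacian (C : Matrix Γ Γ R) (Y : Γ) (a : GrassmannAlgebra R Γ) :
    grassmannDeriv R Y (grassmannLaplacian R C a) = grassmannLaplacian R C (grassmannDeriv R Y a) := by
  rw [grassmannLaplacian_apply, grassmannLaplacian_apply, LinearMap.map_smul_of_tower, map_sum]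
  congr 1
  refine Finset.sum_congr rfl fun U _ => ?_
  rw [map_sum]
  refine Finset.sum_congr rfl fun V _ => ?_
  rw [map_smul, grassmannDeriv_grassmannDeriv_comm R Y U, grassmannDeriv_grassmannDeriv_comm R Y V, map_neg, neg_neg]

omit [DecidableEq Γ] in
/-- Derivatives commute with powers of the Laplacian. [folklore] -/
theorem grassmannDeriv_grassmannLaplacian_pow (C : Matrix Γ Γ R) (Y : Γ) (n : ℕ) (a : GrassmannAlgebra R Γ) :
    grassmannDeriv R Y ((grassmannLaplacian R C ^ n) a) = (grassmannLaplacian R C ^ n) (grassmannDeriv R Y a) := by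
  induction n generalizing a with
  | zero => simp
  | succ n ih => rw [pow_succ', Module.End.mul_apply, Module.End.mul_apply, grassmannDeriv_grassmannLaplacian, ih]

omit [DecidableEq Γ] in
/-- **Derivatives commute with the Gaussian convolution**: `∂_Y (μ_C ⋆ a) = μ_C ⋆ (∂_Y a)`. [folklore] -/
theorem grassmannDeriv_gaussConv (C : Matrix Γ Γ R) (Y : Γ) (a : GrassmannAlgebra R Γ) :
    grassmannDeriv R Y (gaussConv R C a) = gaussConv R C (grassmannDeriv R Y a) := by
  obtain ⟨k, hk⟩ := isNilpotent_grassmannLaplacian R C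
  rw [gaussConv, IsNilpotent.exp_eq_sum hk]
  simp only [LinearMap.coe_sum, Finset.sum_apply, LinearMap.smul_apply, map_sum, LinearMap.map_smul_of_tower,
    grassmannDeriv_grassmannLaplacian_pow]

/-- Powers of the Laplacian past one field:
`Δ_C^{n+1} (ψ(X) a) = ψ(X) Δ_C^{n+1} a + (n+1) Σ_Y A(X,Y) ∂_Y (Δ_C^n a)` (the pairing operator commutes with `Δ_C`).
[folklore] -/
theorem grassmannLaplacian_pow_succ_gen_mul (C : Matrix Γ Γ R) (X : Γ) (n : ℕ) (a : GrassmannAlgebra R Γ) :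
    (grassmannLaplacian R C ^ (n + 1)) (gen R X * a) =
      gen R X * (grassmannLaplacian R C ^ (n + 1)) a +
        ((n + 1 : ℕ) : R) • ∑ Y, (((1 / 2 : ℚ) • (1 : R)) * (C Y X - C X Y)) •
          grassmannDeriv R Y ((grassmannLaplacian R C ^ n) a) := by
  induction n generalizing a with
  | zero => simp [grassmannLaplacian_gen_mul]
  | succ n ih =>
    have hcomm : grassmannLaplacian R C (∑ Y, (((1 / 2 : ℚ) • (1 : R)) * (C Y X - C X Y)) •
        grassmannDeriv R Y ((grassmannLaplacian R C ^ n) a)) =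
        ∑ Y, (((1 / 2 : ℚ) • (1 : R)) * (C Y X - C X Y)) • grassmannDeriv R Y ((grassmannLaplacian R C ^ (n + 1)) a) := by
      rw [map_sum]
      refine Finset.sum_congr rfl fun Y _ => ?_
      rw [map_smul, ← grassmannDeriv_grassmannLaplacian, ← Module.End.mul_apply (grassmannLaplacian R C) (_ ^ n),
        ← pow_succ']
    rw [pow_succ', Module.End.mul_apply, ih, map_add, grassmannLaplacian_gen_mul, LinearMap.map_smul_of_tower, hcomm,
      ← Module.End.mul_apply (grassmannLaplacian R C) (_ ^ (n + 1)), ← pow_succ', add_assoc]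
    congr 1
    rw [show (((n + 1 + 1 : ℕ) : R)) = 1 + ((n + 1 : ℕ) : R) by push_cast; ring, add_smul, one_smul]

/-- One Laplacian power, rearranged: `ψ(X) Δ_C^{j+1} a = Δ_C^{j+1}(ψ(X) a) − (j+1) Σ_Y A(X,Y) ∂_Y (Δ_C^j a)`. [folklore] -/
theorem gen_mul_grassmannLaplacian_pow_succ (C : Matrix Γ Γ R) (X : Γ) (j : ℕ) (a : GrassmannAlgebra R Γ) :
    gen R X * (grassmannLaplacian R C ^ (j + 1)) a =
      (grassmannLaplacian R C ^ (j + 1)) (gen R X * a) -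
        ((j + 1 : ℕ) : R) • ∑ Y, (((1 / 2 : ℚ) • (1 : R)) * (C Y X - C X Y)) •
          grassmannDeriv R Y ((grassmannLaplacian R C ^ j) a) :=
  eq_sub_of_add_eq (grassmannLaplacian_pow_succ_gen_mul R C X j a).symm

/-- **The Gaussian convolution past one field**: `μ_C ⋆ (ψ(X) a) = ψ(X)(μ_C ⋆ a) + Σ_Y A(X,Y) ∂_Y (μ_C ⋆ a)`
(`e^{Δ} ψ(X) e^{-Δ} = ψ(X) + [Δ, ψ(X)]`, the commutator commuting with `Δ`). [cite: Salmhofer1999, §4.3.2 (4.90)] -/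
theorem gaussConv_gen_mul (C : Matrix Γ Γ R) (X : Γ) (a : GrassmannAlgebra R Γ) :
    gaussConv R C (gen R X * a) =
      gen R X * gaussConv R C a +
        ∑ Y, (((1 / 2 : ℚ) • (1 : R)) * (C Y X - C X Y)) • grassmannDeriv R Y (gaussConv R C a) := by
  -- the pairing operator as ONE linear map
  set D : GrassmannAlgebra R Γ →ₗ[R] GrassmannAlgebra R Γ :=
    ∑ Y, (((1 / 2 : ℚ) • (1 : R)) * (C Y X - C X Y)) • grassmannDeriv R Y with hD
  have hDapp : ∀ b : GrassmannAlgebra R Γ,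
      ∑ Y, (((1 / 2 : ℚ) • (1 : R)) * (C Y X - C X Y)) • grassmannDeriv R Y b = D b := by
    intro b
    simp only [hD, LinearMap.coe_sum, Finset.sum_apply, LinearMap.smul_apply]
  rw [hDapp]
  -- rearranged form `ψ(X)(μ ⋆ a) = μ ⋆ (ψ(X) a) − D (μ ⋆ a)`
  suffices h : gen R X * gaussConv R C a = gaussConv R C (gen R X * a) - D (gaussConv R C a) by
    rw [h]; abel
  obtain ⟨k, hk⟩ := isNilpotent_grassmannLaplacian R C
  have hk1 : grassmannLaplacian R C ^ (k + 1) = 0 := by rw [pow_succ, hk, zero_mul]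
  have hexp : ∀ b : GrassmannAlgebra R Γ, gaussConv R C b =
      ∑ i ∈ Finset.range (k + 1), ((i.factorial : ℚ)⁻¹) • (grassmannLaplacian R C ^ i) b := by
    intro b
    rw [gaussConv, IsNilpotent.exp_eq_sum hk1]
    simp only [LinearMap.coe_sum, Finset.sum_apply, LinearMap.smul_apply]
  have hpow : ∀ j : ℕ, gen R X * (grassmannLaplacian R C ^ (j + 1)) a =
      (grassmannLaplacian R C ^ (j + 1)) (gen R X * a) - ((j + 1 : ℕ) : R) • D ((grassmannLaplacian R C ^ j) a) := by
    intro j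
    rw [gen_mul_grassmannLaplacian_pow_succ, hDapp]
  rw [hexp a, hexp (gen R X * a), Finset.mul_sum, map_sum]
  -- split off the `i = 0` terms of the two exponential sums and the (vanishing) `i = k` term of the `D` sum
  rw [Finset.sum_range_succ' _ k, Finset.sum_range_succ' (fun i => ((i.factorial : ℚ)⁻¹) • _) k,
    Finset.sum_range_succ (fun i => D (((i.factorial : ℚ)⁻¹) • _)) k]
  simp only [pow_zero, Module.End.one_apply, Nat.factorial_zero, Nat.cast_one, inv_one, one_smul,
    LinearMap.map_smul_of_tower, hk, LinearMap.zero_apply, smul_zero, mul_smul_comm, hpow,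
    smul_sub, Finset.sum_sub_distrib, inv_factorial_succ_smul_succ_smul, map_zero, add_zero]
  abel

/-! ### Integration by parts and Wick's rule -/

/-- **Integration by parts (Wick's rule)** for the Grassmann Gaussian expectation of ANY covariance:
`∫ dμ_C ψ(X) a = Σ_Y A(X,Y) ∫ dμ_C ∂_Y a`, `A(X,Y) = ½(C(Y,X) − C(X,Y)) = ∫ dμ_C ψ(X)ψ(Y)`
(Salmhofer 1999, (4.91); Feldman–Knörrer–Trubowitz 2002, §I.2). [cite: Salmhofer1999, §4.3.2 (4.91)] -/
theorem gaussExpect_gen_mul (C : Matrix Γ Γ R) (X : Γ) (a : GrassmannAlgebra R Γ) :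
    gaussExpect R C (gen R X * a) =
      ∑ Y, (((1 / 2 : ℚ) • (1 : R)) * (C Y X - C X Y)) * gaussExpect R C (grassmannDeriv R Y a) := by
  rw [gaussExpect_apply, gaussConv_gen_mul, map_add, map_mul, constPart_gen, zero_mul, zero_add, map_sum]
  refine Finset.sum_congr rfl fun Y _ => ?_
  rw [map_smul, smul_eq_mul, grassmannDeriv_gaussConv, ← gaussExpect_apply]

/-- One field has zero expectation. [folklore] -/
theorem gaussExpect_gen (C : Matrix Γ Γ R) (X : Γ) : gaussExpect R C (gen R X) = 0 := by
  have h := gaussExpect_gen_mul R C X 1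
  rw [mul_one] at h
  rw [h]
  simp

/-- Three fields have zero expectation. [folklore] -/
theorem gaussExpect_gen_mul_gen_mul_gen (C : Matrix Γ Γ R) (X Y Z : Γ) :
    gaussExpect R C (gen R X * gen R Y * gen R Z) = 0 := by
  rw [mul_assoc, gaussExpect_gen_mul]
  refine Finset.sum_eq_zero fun W _ => ?_
  rw [grassmannDeriv_gen_mul_gen, map_sub]
  simp [apply_ite (gaussExpect R C), gaussExpect_gen]

/-- **The four-point Wick (Pfaffian) rule**: with `A(X,Y) = ∫ dμ_C ψ(X)ψ(Y) = ½(C(Y,X) − C(X,Y))`,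
`∫ dμ_C ψ(X₁)ψ(X₂)ψ(X₃)ψ(X₄) = A₁₂ A₃₄ − A₁₃ A₂₄ + A₁₄ A₂₃` (Feldman–Knörrer–Trubowitz 2002, §I.2;
Salmhofer 1999, §4.3). [cite: Salmhofer1999, §4.3.2 (4.91)] -/
theorem gaussExpect_gen_mul_gen_mul_gen_mul_gen (C : Matrix Γ Γ R) (X₁ X₂ X₃ X₄ : Γ) :
    gaussExpect R C (gen R X₁ * gen R X₂ * gen R X₃ * gen R X₄) =
      gaussExpect R C (gen R X₁ * gen R X₂) * gaussExpect R C (gen R X₃ * gen R X₄) -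
        gaussExpect R C (gen R X₁ * gen R X₃) * gaussExpect R C (gen R X₂ * gen R X₄) +
        gaussExpect R C (gen R X₁ * gen R X₄) * gaussExpect R C (gen R X₂ * gen R X₃) := by
  rw [mul_assoc, mul_assoc, gaussExpect_gen_mul]
  have hderiv : ∀ W : Γ, grassmannDeriv R W (gen R X₂ * (gen R X₃ * gen R X₄)) =
      (if W = X₂ then gen R X₃ * gen R X₄ else 0) - (if W = X₃ then gen R X₂ * gen R X₄ else 0) +
        (if W = X₄ then gen R X₂ * gen R X₃ else 0) := by
    intro W
    rw [grassmannDeriv_gen_mul, grassmannDeriv_gen_mul_gen]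
    split_ifs <;> simp [mul_sub] <;> abel
  simp only [hderiv, map_add, map_sub, apply_ite (gaussExpect R C), map_zero, gaussExpect_gen_mul_gen, mul_add, mul_sub,
    mul_ite, mul_zero, Finset.sum_add_distrib, Finset.sum_sub_distrib, Finset.sum_ite_eq', Finset.mem_univ, if_true]

end Literature.MathematicalPhysics.QuantumLattice
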